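import Summits.RiemannHypothesis.RiemannHypothesis.Theorems.WeilTwoPrimeDeflM78FBase
import Literature.NumberTheory.LFunctions.WeilBlockRowsFast
import HarnessLib

/-!
# Deflated two-prime certificate (weilCertDeflM78F): the Bessel block claim `Hp = C H Cᵀ` (parity 1), rows 65–69, fast check

`WeilCert.checkHpRowT` (linear traversals) instead of the indexed `checkHpRow` decide.  Pure proof file.
-/

noncomputable section

set_option linter.dupNamespace false

namespace Summit.RiemannHypothesis.RiemannHypothesis.Theorems.EvenWinsBeyondArch

open Literature.NumberTheory.LFunctions

set_option maxHeartbeats 0 in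
/-- Fast kernel check of claim row 65 of `Hp = C H Cᵀ` (parity 1; linear traversals, triangular `C`). [folklore] -/
theorem checkHpRowT1_65_weilCertDeflM78F : weilCertDeflM78FBase.checkHpRowT weilCertDeflM78FHpO 1 65 = true := by
  decide +kernel

/-- Claim row 65 of `Hp = C H Cᵀ` (parity 1), from the fast check. [folklore] -/
theorem checkHpRow1_65_weilCertDeflM78F : weilCertDeflM78FBase.checkHpRow weilCertDeflM78FHpO 1 65 = true :=
  WeilCert.checkHpRow_of_T checkHpRowT1_65_weilCertDeflM78F

set_option maxHeartbeats 0 in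
/-- Fast kernel check of claim row 66 of `Hp = C H Cᵀ` (parity 1; linear traversals, triangular `C`). [folklore] -/
theorem checkHpRowT1_66_weilCertDeflM78F : weilCertDeflM78FBase.checkHpRowT weilCertDeflM78FHpO 1 66 = true := by
  decide +kernel

/-- Claim row 66 of `Hp = C H Cᵀ` (parity 1), from the fast check. [folklore] -/
theorem checkHpRow1_66_weilCertDeflM78F : weilCertDeflM78FBase.checkHpRow weilCertDeflM78FHpO 1 66 = true :=
  WeilCert.checkHpRow_of_T checkHpRowT1_66_weilCertDeflM78F

set_option maxHeartbeats 0 in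
/-- Fast kernel check of claim row 67 of `Hp = C H Cᵀ` (parity 1; linear traversals, triangular `C`). [folklore] -/
theorem checkHpRowT1_67_weilCertDeflM78F : weilCertDeflM78FBase.checkHpRowT weilCertDeflM78FHpO 1 67 = true := by
  decide +kernel

/-- Claim row 67 of `Hp = C H Cᵀ` (parity 1), from the fast check. [folklore] -/
theorem checkHpRow1_67_weilCertDeflM78F : weilCertDeflM78FBase.checkHpRow weilCertDeflM78FHpO 1 67 = true :=
  WeilCert.checkHpRow_of_T checkHpRowT1_67_weilCertDeflM78F

set_option maxHeartbeats 0 in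
/-- Fast kernel check of claim row 68 of `Hp = C H Cᵀ` (parity 1; linear traversals, triangular `C`). [folklore] -/
theorem checkHpRowT1_68_weilCertDeflM78F : weilCertDeflM78FBase.checkHpRowT weilCertDeflM78FHpO 1 68 = true := by
  decide +kernel

/-- Claim row 68 of `Hp = C H Cᵀ` (parity 1), from the fast check. [folklore] -/
theorem checkHpRow1_68_weilCertDeflM78F : weilCertDeflM78FBase.checkHpRow weilCertDeflM78FHpO 1 68 = true :=
  WeilCert.checkHpRow_of_T checkHpRowT1_68_weilCertDeflM78F

set_option maxHeartbeats 0 in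
/-- Fast kernel check of claim row 69 of `Hp = C H Cᵀ` (parity 1; linear traversals, triangular `C`). [folklore] -/
theorem checkHpRowT1_69_weilCertDeflM78F : weilCertDeflM78FBase.checkHpRowT weilCertDeflM78FHpO 1 69 = true := by
  decide +kernel

/-- Claim row 69 of `Hp = C H Cᵀ` (parity 1), from the fast check. [folklore] -/
theorem checkHpRow1_69_weilCertDeflM78F : weilCertDeflM78FBase.checkHpRow weilCertDeflM78FHpO 1 69 = true :=
  WeilCert.checkHpRow_of_T checkHpRowT1_69_weilCertDeflM78F

end Summit.RiemannHypothesis.RiemannHypothesis.Theorems.EvenWinsBeyondArch
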